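import Summits.NavierStokesRegularity.NavierStokesRegularity.Theses.SlicedKelvin
import Literature.Analysis.FluidPDE.AncientMildCompactness
import Literature.Analysis.FluidPDE.ClassicalSolutionRescale
import Summits.NavierStokesRegularity.NavierStokesRegularity.Theorems.SlicedKelvinFluxZoomStubSubslabBounds
import Summits.NavierStokesRegularity.NavierStokesRegularity.Theorems.SlicedKelvinFluxZoomStubNearFieldFlux
import Summits.NavierStokesRegularity.NavierStokesRegularity.Theorems.SlicedKelvinFluxZoomStubUnitScaleVelocity
import Summits.NavierStokesRegularity.NavierStokesRegularity.Theorems.SlicedKelvinFluxZoomStubFluxVelocity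
import Summits.NavierStokesRegularity.NavierStokesRegularity.Theorems.SlicedKelvinFluxZoomStubOseenBoxRegularity
import Summits.NavierStokesRegularity.NavierStokesRegularity.Theorems.SlicedKelvinFluxZoomStubOseenAncientMild
import Summits.NavierStokesRegularity.NavierStokesRegularity.Theorems.SlicedKelvinFluxZoomStubFderivLimit
import Summits.NavierStokesRegularity.NavierStokesRegularity.Theorems.SlicedKelvinFluxZoomStubOseenWindowShift
import Summits.NavierStokesRegularity.NavierStokesRegularity.Theorems.SlicedKelvinFluxZoomStubSliceFDerivContinuous
import Summits.NavierStokesRegularity.NavierStokesRegularity.Theorems.SlicedKelvinFluxZoomStubZoomBookkeeping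
import Summits.NavierStokesRegularity.NavierStokesRegularity.Theorems.SlicedKelvinFluxZoomStubViscosityNormalization
import Summits.NavierStokesRegularity.NavierStokesRegularity.Theorems.SlicedKelvinFluxZoomStubZoomCoreUnit
import HarnessLib.Audit

/-!
# Skeleton (lead's reshape of the BC3 birth skeleton) of the crux `SlicedKelvin.FluxZoom`

(crux item `stmt-NavierStokesRegularity-15603`, route `route-NavierStokesRegularity-SlicedKelvin`;
line `registered` = `Cruxes/FluxZoom/Lines/birth.lean`; lead `prover-line-stmt-NavierStokesRegularity-15603-0`.)

THE CRUX. `FluxZoom` (vorticity-record zoom at bounded planar flux): a classical Leray–Hopf solution from a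
rapidly decaying datum with NO smooth extension past `T` but unsigned planar vorticity flux `≤ M` on `[0,T)`
produces a bounded ancient mild solution `v` (`ν = 1`), measurable and jointly smooth on `(−∞,0) × ℝ³`, with
bounded planar flux on every plane and slice, NON-CONSTANT on some slice `t < 0`.

THE CUT (same composition idea as the birth skeleton — BKM turns "no extension" into "vorticity unbounded
on `[0,T)`", then the vorticity-clock KNSS zoom — with the L-sized zoom stub cut into independently provable
registered pieces whose STATEMENTS the core stub takes as antecedents):

* `stub_subslabBounds` [S–M] — (a) sup-form Beale–Kato–Majda in the route's class (vorticity bounded on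
  `[0,T) × ℝ³` ⇒ `HasSmoothExtensionPast`) and (b) velocity AND vorticity bounded on every closed sub-slab
  `[0,T'] × ℝ³`, `0 < T' < T` (Tao 2013 `tao2011_hasBoundedSobolevNormsOn_holds` +
  `exists_enorm_curl_le_of_hasBoundedSobolevNormsOn` + `linfty_bound_of_hasBoundedSobolevNormsOn_holds` +
  `beale_kato_majda_holds`; verbatim the pattern of `Theorems/CoreLogGasCoreReductionContinuation.lean`).
* `stub_nearFieldFlux` [M] — the near-field Biot–Savart integral at bounded planar flux:
  `∫_{B(x,2)} |ω(y)|/|x−y|² dy ≤ 4πrW + 12Φ/r` for `0 < r ≤ 1`, `|ω| ≤ W`, flux `≤ Φ` through every plane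
  (inner ball `B(x,r)`: `W ∫ |x−y|⁻² = 4πrW`; shell: `|ω| ≤ Σᵢ|ωᵢ|`, and on the plane `{yᵢ = c}` the kernel is
  `≤ max(|c−xᵢ|, r)⁻²`, so slicing by the planes normal to `eᵢ` (`exists_measurableEquiv_line`-type
  volume-preserving `ℝ³ ≃ ℝ × ℝ²`, and the isometry invariance of the flux hypothesis) gives `≤ 4Φ/r` each).
* `stub_unitScaleVelocity` [M] — `stub_nearFieldFlux`'s statement ⇒ unit-scale velocity bound
  `‖v(x)‖ ≤ rW + 3Φ/(πr) + C_v‖v‖_{L²}` for `C²` divergence-free `v ∈ L²` (the local Helmholtz identity at a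
  point `eq_biotSavart_curl_smul_add`, NO decay of `v` needed; proof = `exists_norm_sub_biotSavart_le` with
  `b = 0` and its "bound 1" replaced by the near-field flux bound).
* `stub_fluxVelocity` [M] — `stub_unitScaleVelocity`'s statement ⇒ `‖v(x)‖² ≤ (12/π)·W·Φ` (NS scaling
  `v ↦ ℓ v(x₀ + ℓ·)`: `W ↦ ℓ²W`, `Φ ↦ Φ`, `‖v‖₂ ↦ ℓ^{-1/2}‖v‖₂`; take `r = ρ/ℓ`, `ℓ → ∞`, optimise `ρ`). This is
  the route's support `FluxVelocityBound` in the class where it is TRUE and needed (`u(t) ∈ C² ∩ L²`, not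
  `HasRapidSpatialDecay (u t)` — refuter note 0816T15-5).
* `stub_oseenBoxRegularity` [M] — bounded continuous Oseen-mild fields on a window `(0,T)` (the class of
  `KNSS2009_lemma61_oseenMild`) are jointly smooth, divergence free, with `k`-th derivative bounds and
  time-Lipschitz bounds on `(δ,T)` UNIFORM in the field (`KNSS2009_mild_regularity_holds`,
  `KNSS2009_prop41_mild_holds` through `IsKNSSDriftMild T N V' 0` for the measurable modification
  `V' = 1_{(0,T)} V`, `driftDuhamel_zero_eq_oseenDuhamel`).
* `stub_oseenAncientMild` [S–M] — bounded continuous Oseen-ancient fields are bounded ancient mild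
  solutions in the duality sense with measurable slices (pattern `IsTypeIAncientMild.isMildNSSolutionBetween`:
  `integral_inner_oseenDuhamel_eq_neg_intervalIntegral`, `integral_inner_heatExtension_comm_of_bound`).
* `stub_zoomCore` [L — the lead's stub] — the vorticity-clock zoom itself, taking the statements of
  `stub_fluxVelocity`, `stub_oseenBoxRegularity`, `stub_oseenAncientMild` as antecedents: near-record
  points `(t_k,x_k)` with `|ω(t_k,x_k)| = w_k → ∞` and `|ω| ≤ 2w_k` on `[0,t_k]`; rescaling
  `v_k = (λ_k/ν) • stPull (λ_k²/ν) λ_k t_k x_k u`, `λ_k² = ν/w_k` (`IsClassicalNSSolutionOn.stRescale`,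
  viscosity `→ 1`; `|curl v_k| ≤ 2` on `s ≤ 0`, `|curl v_k(0,0)| = 1`, `|v_k|² ≤ 24M/(πν)` by
  `stub_fluxVelocity`, flux `≤ M/ν`); Oseen-mildness of the `v_k` (`mild_of_bounded_of_eLpNorm_two_le_of_lt`,
  Leray–Hopf energy); compactness (`KNSS2009_lemma61_oseenMild`); `C¹` convergence from the uniform `C²`
  bounds of `stub_oseenBoxRegularity`; Fatou on every plane; and `|curl v(s*,0)| ≥ 1/2` at a FIXED `s* < 0`
  from the uniform time-Lipschitz bound of `∇v_k` up to the final time.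

`FluxZoom_of : Theses.SlicedKelvin.FluxZoom` (the ONLY theorem of this file concluding the crux; conclusion
= the crux BY NAME, no `Prop` hypotheses, placeholders only inside the declared stubs, which it uses by
name) is the real composition.

Disproof used: none — `Cruxes/FluxZoom/` has no `Disproof.lean` / `Negative/` lemma (2026-08-17,
`ledger crux ls`). NB for the whole line: the in-tree `KNSS2009_blowup_generates_ancient_holds` is discharged
by CONSTANT fields (its vendored conclusion does not mention `u`), so it is NOT a zoom engine; the real
velocity-clock zoom of the tree is `KNSSTypeIIProofs.KNSS2009_regularity_bound_C_over_r_one`.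
-/

noncomputable section

open Set MeasureTheory Filter Topology

namespace Summit.NavierStokesRegularity.NavierStokesRegularity.Cruxes.FluxZoom.Birth

set_option linter.unusedVariables false
set_option linter.dupNamespace false

/-- **stub 1 — `stub_subslabBounds` (S–M, provable now).** For a classical solution of the unforced system
(`ν > 0`) on `ℝ³ × [0,T)`, Leray–Hopf from its rapidly decaying datum: (a) if its vorticity is bounded on
`[0,T) × ℝ³` it extends smoothly past `T` (sup-form Beale–Kato–Majda: `beale_kato_majda_holds` with the BKM
class on closed sub-slabs from `tao2011_hasBoundedSobolevNormsOn_holds`); (b) on every closed sub-slab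
`[0,T'] × ℝ³`, `0 < T' < T`, velocity and vorticity are bounded (`linfty_bound_of_hasBoundedSobolevNormsOn_holds`,
`exists_enorm_curl_le_of_hasBoundedSobolevNormsOn`). Pattern: `CoreLogGasCoreReductionContinuation`, Steps 3–6. -/
theorem stub_subslabBounds :
    ∀ (ν T : ℝ), 0 < ν → 0 < T →
      ∀ (u : ℝ → EuclideanSpace ℝ (Fin 3) → EuclideanSpace ℝ (Fin 3))
        (p : ℝ → EuclideanSpace ℝ (Fin 3) → ℝ),
        Literature.Analysis.FluidPDE.IsClassicalNSSolutionOn (Set.Ico 0 T) ν 0 u p →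
        Literature.Analysis.FluidPDE.IsLerayHopfOn T ν 0 (u 0) u →
        Literature.Analysis.FluidPDE.HasRapidSpatialDecay (u 0) →
        ((∃ W : ℝ, ∀ t ∈ Set.Ico 0 T, ∀ x, ‖Literature.Analysis.FluidPDE.curl (u t) x‖ ≤ W) →
            Literature.Analysis.FluidPDE.HasSmoothExtensionPast ν 0 u T) ∧
        (∀ T' ∈ Set.Ioo 0 T, ∃ B : ℝ, ∀ t ∈ Set.Icc 0 T', ∀ x,
            ‖u t x‖ ≤ B ∧ ‖Literature.Analysis.FluidPDE.curl (u t) x‖ ≤ B) :=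
  Theorems.FluxZoom.Registered.stub_subslabBounds

/-- **stub 2 — `stub_nearFieldFlux` (M, provable now: the near-field Biot–Savart integral at bounded planar
flux).** For a continuous field `ω` on `ℝ³` with `|ω| ≤ W` and unsigned flux `≤ Φ` through every plane
`R({y₂ = c})`, every `x` and `0 < r ≤ 1`: `y ↦ |ω(y)|/|x−y|²` is integrable on `B(x,2)` and
`∫_{B(x,2)} |ω(y)|/|x−y|² dy ≤ 4πrW + 12Φ/r` (ball `B(x,r)`: `W·4πr`; shell: `|ω| ≤ Σᵢ|ωᵢ|`, and sliced by the
planes `{yᵢ = c}` — where `|x−y|⁻² ≤ max(|c−xᵢ|,r)⁻²` — each component contributes `≤ Φ∫max(|h|,r)⁻²dh ≤ 4Φ/r`). -/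
theorem stub_nearFieldFlux :
    ∀ (ω : EuclideanSpace ℝ (Fin 3) → EuclideanSpace ℝ (Fin 3)), Continuous ω →
      ∀ (W Φ : ℝ), 0 ≤ W → 0 ≤ Φ → (∀ x, ‖ω x‖ ≤ W) →
        (∀ (R : EuclideanSpace ℝ (Fin 3) ≃ₗᵢ[ℝ] EuclideanSpace ℝ (Fin 3)) (c : ℝ),
          ∫⁻ y : EuclideanSpace ℝ (Fin 2),
            ‖inner ℝ (ω (R (WithLp.toLp 2 ![y 0, y 1, c]))) (R (EuclideanSpace.single 2 1))‖ₑ ≤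
              ENNReal.ofReal Φ) →
        ∀ (x : EuclideanSpace ℝ (Fin 3)) (r : ℝ), 0 < r → r ≤ 1 →
          MeasureTheory.IntegrableOn (fun y => ‖ω y‖ / ‖x - y‖ ^ 2) (Metric.ball x 2)
              MeasureTheory.volume ∧
            ∫ y in Metric.ball x 2, ‖ω y‖ / ‖x - y‖ ^ 2 ≤ 4 * Real.pi * r * W + 12 * Φ / r :=
  Theorems.FluxZoom.Registered.stub_nearFieldFlux

/-- **stub 3 — `stub_unitScaleVelocity` (M, provable now: the local Helmholtz identity at a point).**
The statement of `stub_nearFieldFlux` implies: there is an absolute `C_v ≥ 0` such that every `C²`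
divergence-free `v ∈ L²(ℝ³)` with `|curl v| ≤ W` and planar flux of `curl v` `≤ Φ` satisfies, for every `x` and
`0 < r ≤ 1`, `‖v(x)‖ ≤ rW + 3Φ/(πr) + C_v‖v‖_{L²}` (`eq_biotSavart_curl_smul_add`: `v(x) = K∗curl(φv)(x) +
Σⱼ(∫∂ⱼΓ⟪v,∇φ⟫)eⱼ`, `curl(φv) = φ curl v + ∇φ × v`; the near field `K∗(φ curl v)(x)` is
`≤ (4π)⁻¹∫_{B(x,2)}|curl v|/|x−y|²`, the two cutoff terms live on the shell `1 ≤ |x−y| ≤ 2` and cost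
`C_v‖v‖₂` exactly as in `exists_norm_sub_biotSavart_le`). -/
theorem stub_unitScaleVelocity :
    (∀ (ω : EuclideanSpace ℝ (Fin 3) → EuclideanSpace ℝ (Fin 3)), Continuous ω →
      ∀ (W Φ : ℝ), 0 ≤ W → 0 ≤ Φ → (∀ x, ‖ω x‖ ≤ W) →
        (∀ (R : EuclideanSpace ℝ (Fin 3) ≃ₗᵢ[ℝ] EuclideanSpace ℝ (Fin 3)) (c : ℝ),
          ∫⁻ y : EuclideanSpace ℝ (Fin 2),
            ‖inner ℝ (ω (R (WithLp.toLp 2 ![y 0, y 1, c]))) (R (EuclideanSpace.single 2 1))‖ₑ ≤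
              ENNReal.ofReal Φ) →
        ∀ (x : EuclideanSpace ℝ (Fin 3)) (r : ℝ), 0 < r → r ≤ 1 →
          MeasureTheory.IntegrableOn (fun y => ‖ω y‖ / ‖x - y‖ ^ 2) (Metric.ball x 2)
              MeasureTheory.volume ∧
            ∫ y in Metric.ball x 2, ‖ω y‖ / ‖x - y‖ ^ 2 ≤ 4 * Real.pi * r * W + 12 * Φ / r) →
    ∃ Cv : ℝ, 0 ≤ Cv ∧
      ∀ (v : EuclideanSpace ℝ (Fin 3) → EuclideanSpace ℝ (Fin 3)), ContDiff ℝ 2 v →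
        Literature.Analysis.FluidPDE.VectorCalculus.IsDivFree v →
        (∫⁻ y, ‖v y‖ₑ ^ 2 < ⊤) →
        ∀ (W Φ : ℝ), 0 ≤ W → 0 ≤ Φ →
          (∀ x, ‖Literature.Analysis.FluidPDE.curl v x‖ ≤ W) →
          (∀ (R : EuclideanSpace ℝ (Fin 3) ≃ₗᵢ[ℝ] EuclideanSpace ℝ (Fin 3)) (c : ℝ),
            ∫⁻ y : EuclideanSpace ℝ (Fin 2),
              ‖inner ℝ (Literature.Analysis.FluidPDE.curl v (R (WithLp.toLp 2 ![y 0, y 1, c])))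
                (R (EuclideanSpace.single 2 1))‖ₑ ≤ ENNReal.ofReal Φ) →
          ∀ (x : EuclideanSpace ℝ (Fin 3)) (r : ℝ), 0 < r → r ≤ 1 →
            ‖v x‖ ≤ r * W + 3 * Φ / (Real.pi * r) +
              Cv * (MeasureTheory.eLpNorm v 2 MeasureTheory.volume).toReal :=
  Theorems.FluxZoom.Registered.stub_unitScaleVelocity

/-- **stub 4 — `stub_fluxVelocity` (M, provable now: scaling out the energy).** The statement of
`stub_unitScaleVelocity` implies the scale-invariant bound `‖v(x)‖² ≤ (12/π)·W·Φ` for every `C²`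
divergence-free `v ∈ L²(ℝ³)` with `|curl v| ≤ W` and planar flux `≤ Φ` (apply the unit-scale bound to
`v_ℓ = ℓ • v(x + ℓ •·)` at `0` with `r = ρ/ℓ`: `|curl v_ℓ| ≤ ℓ²W`, flux of `curl v_ℓ` `≤ Φ`, `‖v_ℓ‖₂ = ℓ^{-1/2}‖v‖₂`,
so `‖v(x)‖ ≤ ρW + 3Φ/(πρ) + C_vℓ^{-3/2}‖v‖₂`; let `ℓ → ∞`, then optimise `ρ`). The route's `FluxVelocityBound`
(stmt-15604) in the class where it is true and needed. -/
theorem stub_fluxVelocity :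
    (∃ Cv : ℝ, 0 ≤ Cv ∧
      ∀ (v : EuclideanSpace ℝ (Fin 3) → EuclideanSpace ℝ (Fin 3)), ContDiff ℝ 2 v →
        Literature.Analysis.FluidPDE.VectorCalculus.IsDivFree v →
        (∫⁻ y, ‖v y‖ₑ ^ 2 < ⊤) →
        ∀ (W Φ : ℝ), 0 ≤ W → 0 ≤ Φ →
          (∀ x, ‖Literature.Analysis.FluidPDE.curl v x‖ ≤ W) →
          (∀ (R : EuclideanSpace ℝ (Fin 3) ≃ₗᵢ[ℝ] EuclideanSpace ℝ (Fin 3)) (c : ℝ),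
            ∫⁻ y : EuclideanSpace ℝ (Fin 2),
              ‖inner ℝ (Literature.Analysis.FluidPDE.curl v (R (WithLp.toLp 2 ![y 0, y 1, c])))
                (R (EuclideanSpace.single 2 1))‖ₑ ≤ ENNReal.ofReal Φ) →
          ∀ (x : EuclideanSpace ℝ (Fin 3)) (r : ℝ), 0 < r → r ≤ 1 →
            ‖v x‖ ≤ r * W + 3 * Φ / (Real.pi * r) +
              Cv * (MeasureTheory.eLpNorm v 2 MeasureTheory.volume).toReal) →
    ∀ (v : EuclideanSpace ℝ (Fin 3) → EuclideanSpace ℝ (Fin 3)), ContDiff ℝ 2 v →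
      Literature.Analysis.FluidPDE.VectorCalculus.IsDivFree v →
      (∫⁻ y, ‖v y‖ₑ ^ 2 < ⊤) →
      ∀ (W Φ : ℝ), 0 ≤ W → 0 ≤ Φ →
        (∀ x, ‖Literature.Analysis.FluidPDE.curl v x‖ ≤ W) →
        (∀ (R : EuclideanSpace ℝ (Fin 3) ≃ₗᵢ[ℝ] EuclideanSpace ℝ (Fin 3)) (c : ℝ),
          ∫⁻ y : EuclideanSpace ℝ (Fin 2),
            ‖inner ℝ (Literature.Analysis.FluidPDE.curl v (R (WithLp.toLp 2 ![y 0, y 1, c])))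
              (R (EuclideanSpace.single 2 1))‖ₑ ≤ ENNReal.ofReal Φ) →
        ∀ x, ‖v x‖ ^ 2 ≤ 12 / Real.pi * W * Φ :=
  Theorems.FluxZoom.Registered.stub_fluxVelocity

/-- **stub 5 — `stub_oseenBoxRegularity` (M, provable now: KNSS §4 for bounded Oseen-mild fields on a
window, with constants uniform in the field).** For every `N` and `T > 0` there are `C L : ℕ → ℝ → ℝ`
such that every field `V`, continuous on `(0,T) × ℝ³`, with weakly divergence-free slices, bounded by `N`,
and satisfying the Oseen identity `V(t) = e^{(t−s)Δ}V(s) − B¹_s(V,V)(t)` for all `0 < s < t < T`, is jointly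
`C^∞` on `(0,T) × ℝ³`, has divergence-free slices, `‖∇ᵏV(t,x)‖ ≤ C k δ` on `(δ,T)` and
`‖∇ᵏV(t,x) − ∇ᵏV(s,x)‖ ≤ L k δ·|t−s|` for `s,t ∈ (δ,T)` (`KNSS2009_mild_regularity_holds` and the joint
smoothness of `KNSS2009_prop41_mild_holds`, applied to the drift-mild structure `IsKNSSDriftMild T N V' 0` of
the measurable modification `V' = 1_{(0,T)}V`; `driftDuhamel_zero_eq_oseenDuhamel`). -/
theorem stub_oseenBoxRegularity :
    ∀ (N T : ℝ), 0 < T → ∃ (C L : ℕ → ℝ → ℝ),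
      ∀ (V : ℝ → EuclideanSpace ℝ (Fin 3) → EuclideanSpace ℝ (Fin 3)),
        ContinuousOn (Function.uncurry V) (Set.Ioo 0 T ×ˢ Set.univ) →
        (∀ t ∈ Set.Ioo 0 T, Literature.Analysis.FluidPDE.IsWeaklyDivFree (V t)) →
        (∀ t ∈ Set.Ioo 0 T, ∀ x, ‖V t x‖ ≤ N) →
        (∀ s t : ℝ, 0 < s → s < t → t < T → ∀ x,
          V t x = Literature.Analysis.UnboundedOperators.heatExtension (V s) (t - s) x -
            Literature.Analysis.FluidPDE.oseenDuhamel 1 s V V t x) →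
        ContDiffOn ℝ (⊤ : ℕ∞) (Function.uncurry V) (Set.Ioo 0 T ×ˢ Set.univ) ∧
        (∀ t ∈ Set.Ioo 0 T, Literature.Analysis.FluidPDE.VectorCalculus.IsDivFree (V t)) ∧
        (∀ δ : ℝ, 0 < δ → ∀ k : ℕ, ∀ t ∈ Set.Ioo δ T, ∀ x,
          ‖iteratedFDeriv ℝ k (V t) x‖ ≤ C k δ) ∧
        (∀ δ : ℝ, 0 < δ → ∀ k : ℕ, ∀ s ∈ Set.Ioo δ T, ∀ t ∈ Set.Ioo δ T, ∀ x,
          ‖iteratedFDeriv ℝ k (V t) x - iteratedFDeriv ℝ k (V s) x‖ ≤ L k δ * |t - s|) :=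
  Theorems.FluxZoom.Registered.stub_oseenBoxRegularity

/-- **stub 6 — `stub_oseenAncientMild` (S–M, provable now: Oseen integral form ⇒ duality form).** A field
`V`, continuous on `(−∞,0) × ℝ³`, with weakly divergence-free slices, bounded by `N`, satisfying the Oseen
identity for all `s < t < 0`, is a bounded ancient mild solution in the duality sense of `SelfSimilar.lean`
(`IsBoundedAncientMildSolution 1 V`) with measurable slices (pattern: `IsTypeIAncientMild.isMildNSSolutionBetween`
with the constant bound `N`: `integral_inner_oseenDuhamel_eq_neg_intervalIntegral`,
`integral_inner_heatExtension_comm_of_bound`, `exists_norm_oseenDuhamel_bounded_le`). -/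
theorem stub_oseenAncientMild :
    ∀ (V : ℝ → EuclideanSpace ℝ (Fin 3) → EuclideanSpace ℝ (Fin 3)) (N : ℝ),
      ContinuousOn (Function.uncurry V) (Set.Iio 0 ×ˢ Set.univ) →
      (∀ t < 0, Literature.Analysis.FluidPDE.IsWeaklyDivFree (V t)) →
      (∀ t < 0, ∀ x, ‖V t x‖ ≤ N) →
      (∀ s t : ℝ, s < t → t < 0 → ∀ x,
        V t x = Literature.Analysis.UnboundedOperators.heatExtension (V s) (t - s) x -
          Literature.Analysis.FluidPDE.oseenDuhamel 1 s V V t x) →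
      Literature.Analysis.FluidPDE.IsBoundedAncientMildSolution 1 V ∧
        ∀ t < 0, MeasureTheory.AEStronglyMeasurable (V t) MeasureTheory.volume :=
  Theorems.FluxZoom.Registered.stub_oseenAncientMild

/-- **stub 7 — `stub_fderivLimit` (S–M, pure calculus).** If `f_j → g` locally uniformly on `ℝ³`, the `f_j`
(eventually) and `g` are `C²` with second derivatives bounded by `C`, then `∇f_j(x) → ∇g(x)` (Landau–Kolmogorov
at a point: `‖(∇f_j − ∇g)(x)h‖ ≤ ‖(f_j−g)(x+h)‖ + ‖(f_j−g)(x)‖ + 2C‖h‖²` by the mean value inequality applied to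
`y ↦ (f_j−g)(y) − ∇(f_j−g)(x)y`, then `h = ηe`, `η → 0` slowly). -/
theorem stub_fderivLimit :
    ∀ (C : ℝ) (f : ℕ → EuclideanSpace ℝ (Fin 3) → EuclideanSpace ℝ (Fin 3))
      (g : EuclideanSpace ℝ (Fin 3) → EuclideanSpace ℝ (Fin 3)) (x : EuclideanSpace ℝ (Fin 3)),
      (∀ᶠ j in Filter.atTop, ContDiff ℝ 2 (f j) ∧ ∀ y, ‖iteratedFDeriv ℝ 2 (f j) y‖ ≤ C) →
      ContDiff ℝ 2 g → (∀ y, ‖iteratedFDeriv ℝ 2 g y‖ ≤ C) →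
      TendstoLocallyUniformly f g Filter.atTop →
      Filter.Tendsto (fun j => fderiv ℝ (f j) x) Filter.atTop (nhds (fderiv ℝ g x)) :=
  Theorems.FluxZoom.Registered.stub_fderivLimit

/-- **stub 8 — `stub_oseenWindowShift` (S–M, bookkeeping).** The statement of `stub_oseenBoxRegularity` on the
window `(0,T)` transported to an arbitrary window `(a,b)` by the time shift `V ↦ V(· + a)` (the Oseen identity is
autonomous: `oseenDuhamel_comp_sub_right`; `uncurry V = uncurry V(·+a) ∘ ((t,x) ↦ (t−a,x))` for `ContDiffOn`). -/
theorem stub_oseenWindowShift :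
    (∀ (N T : ℝ), 0 < T → ∃ (C L : ℕ → ℝ → ℝ),
      ∀ (V : ℝ → EuclideanSpace ℝ (Fin 3) → EuclideanSpace ℝ (Fin 3)),
        ContinuousOn (Function.uncurry V) (Set.Ioo 0 T ×ˢ Set.univ) →
        (∀ t ∈ Set.Ioo 0 T, Literature.Analysis.FluidPDE.IsWeaklyDivFree (V t)) →
        (∀ t ∈ Set.Ioo 0 T, ∀ x, ‖V t x‖ ≤ N) →
        (∀ s t : ℝ, 0 < s → s < t → t < T → ∀ x,
          V t x = Literature.Analysis.UnboundedOperators.heatExtension (V s) (t - s) x -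
            Literature.Analysis.FluidPDE.oseenDuhamel 1 s V V t x) →
        ContDiffOn ℝ (⊤ : ℕ∞) (Function.uncurry V) (Set.Ioo 0 T ×ˢ Set.univ) ∧
        (∀ t ∈ Set.Ioo 0 T, Literature.Analysis.FluidPDE.VectorCalculus.IsDivFree (V t)) ∧
        (∀ δ : ℝ, 0 < δ → ∀ k : ℕ, ∀ t ∈ Set.Ioo δ T, ∀ x,
          ‖iteratedFDeriv ℝ k (V t) x‖ ≤ C k δ) ∧
        (∀ δ : ℝ, 0 < δ → ∀ k : ℕ, ∀ s ∈ Set.Ioo δ T, ∀ t ∈ Set.Ioo δ T, ∀ x,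
          ‖iteratedFDeriv ℝ k (V t) x - iteratedFDeriv ℝ k (V s) x‖ ≤ L k δ * |t - s|)) →
    ∀ (N a b : ℝ), a < b → ∃ (C L : ℕ → ℝ → ℝ),
      ∀ (V : ℝ → EuclideanSpace ℝ (Fin 3) → EuclideanSpace ℝ (Fin 3)),
        ContinuousOn (Function.uncurry V) (Set.Ioo a b ×ˢ Set.univ) →
        (∀ t ∈ Set.Ioo a b, Literature.Analysis.FluidPDE.IsWeaklyDivFree (V t)) →
        (∀ t ∈ Set.Ioo a b, ∀ x, ‖V t x‖ ≤ N) →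
        (∀ s t : ℝ, a < s → s < t → t < b → ∀ x,
          V t x = Literature.Analysis.UnboundedOperators.heatExtension (V s) (t - s) x -
            Literature.Analysis.FluidPDE.oseenDuhamel 1 s V V t x) →
        ContDiffOn ℝ (⊤ : ℕ∞) (Function.uncurry V) (Set.Ioo a b ×ˢ Set.univ) ∧
        (∀ t ∈ Set.Ioo a b, Literature.Analysis.FluidPDE.VectorCalculus.IsDivFree (V t)) ∧
        (∀ δ : ℝ, 0 < δ → ∀ k : ℕ, ∀ t ∈ Set.Ioo (a + δ) b, ∀ x,
          ‖iteratedFDeriv ℝ k (V t) x‖ ≤ C k δ) ∧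
        (∀ δ : ℝ, 0 < δ → ∀ k : ℕ, ∀ s ∈ Set.Ioo (a + δ) b, ∀ t ∈ Set.Ioo (a + δ) b, ∀ x,
          ‖iteratedFDeriv ℝ k (V t) x - iteratedFDeriv ℝ k (V s) x‖ ≤ L k δ * |t - s|) :=
  Theorems.FluxZoom.Registered.stub_oseenWindowShift

/-- **stub 9 — `stub_sliceFDerivContinuous` (S, pure calculus).** For a field jointly `C^∞` on an open slab
`(a,b) × ℝ³`, the spatial derivative of the slices `t ↦ ∇(V t)(x)` is continuous on `(a,b)` (chain rule
`fderiv (V t) x = fderiv (uncurry V) (t,x) ∘ inr` and continuity of `fderiv (uncurry V)` on the open slab). -/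
theorem stub_sliceFDerivContinuous :
    ∀ (V : ℝ → EuclideanSpace ℝ (Fin 3) → EuclideanSpace ℝ (Fin 3)) (a b : ℝ),
      ContDiffOn ℝ (⊤ : ℕ∞) (Function.uncurry V) (Set.Ioo a b ×ˢ Set.univ) →
      ∀ x, ContinuousOn (fun t => fderiv ℝ (V t) x) (Set.Ioo a b) :=
  Theorems.FluxZoom.Registered.stub_sliceFDerivContinuous

/-- **stub 10 — `stub_zoomBookkeeping` (S–M, scaling bookkeeping of the zoom `c • stPull (c²) c t₀ x₀ u`,
`v(s,y) = c u(t₀ + c²s, x₀ + cy)`).** (i) `∫|v(s)|² = c⁻¹ ∫|u(t₀+c²s)|²` (`lintegral_comp_space_affine`);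
for a differentiable slice: (ii) `curl v(s) y = c² curl u(t₀+c²s)(x₀+cy)` (`fderiv_stPull`); (iii) the unsigned
flux of `curl v(s)` through the plane `R{y₂ = c'}` equals that of `curl u(t₀+c²s)` through
`R{y₂ = (R⁻¹x₀)₂ + cc'}` (the factor `c²` of (ii) against the Jacobian `c⁻²` of `y ↦ (R⁻¹x₀)' + cy` on `ℝ²`;
pattern: the private `zoom_plane_point`/`curl_zoom` of `Theorems/SlicedKelvinFluxZoomStubFluxVelocity.lean`). -/
theorem stub_zoomBookkeeping :
    ∀ (u : ℝ → EuclideanSpace ℝ (Fin 3) → EuclideanSpace ℝ (Fin 3)) (t₀ : ℝ)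
      (x₀ : EuclideanSpace ℝ (Fin 3)) (c : ℝ), 0 < c → ∀ s : ℝ,
      (∫⁻ y, ‖(c • Literature.Analysis.FluidPDE.stPull (c ^ 2) c t₀ x₀ u) s y‖ₑ ^ 2 =
          ENNReal.ofReal c⁻¹ * ∫⁻ x, ‖u (t₀ + c ^ 2 * s) x‖ₑ ^ 2) ∧
      (Differentiable ℝ (u (t₀ + c ^ 2 * s)) →
        (∀ y, Literature.Analysis.FluidPDE.curl ((c • Literature.Analysis.FluidPDE.stPull (c ^ 2) c t₀ x₀ u) s) y =
          c ^ 2 • Literature.Analysis.FluidPDE.curl (u (t₀ + c ^ 2 * s)) (x₀ + c • y)) ∧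
        (∀ (R : EuclideanSpace ℝ (Fin 3) ≃ₗᵢ[ℝ] EuclideanSpace ℝ (Fin 3)) (c' : ℝ),
          ∫⁻ y : EuclideanSpace ℝ (Fin 2),
            ‖inner ℝ (Literature.Analysis.FluidPDE.curl
                ((c • Literature.Analysis.FluidPDE.stPull (c ^ 2) c t₀ x₀ u) s)
                (R (WithLp.toLp 2 ![y 0, y 1, c']))) (R (EuclideanSpace.single 2 1))‖ₑ =
          ∫⁻ y : EuclideanSpace ℝ (Fin 2),
            ‖inner ℝ (Literature.Analysis.FluidPDE.curl (u (t₀ + c ^ 2 * s))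
                (R (WithLp.toLp 2 ![y 0, y 1, (R.symm x₀) 2 + c * c']))) (R (EuclideanSpace.single 2 1))‖ₑ)) :=
  Theorems.FluxZoom.Registered.stub_zoomBookkeeping

/-- **stub 11 — `stub_zoomCoreUnit` (L — the lead's stub: the vorticity-clock KNSS zoom at bounded planar
flux, unit viscosity).** Assuming the statements of `stub_fluxVelocity`, `stub_oseenWindowShift` (conclusion),
`stub_oseenAncientMild`, `stub_fderivLimit`, `stub_sliceFDerivContinuous`, `stub_zoomBookkeeping`: a classical
solution (`ν = 1`) on `ℝ³ × [0,T)` with slices uniformly in `L²`, planar flux `≤ M` on `[0,T)`, velocity and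
vorticity bounded on every closed sub-slab but vorticity NOT bounded on `[0,T) × ℝ³`, yields a bounded ancient
mild solution `v` (`ν = 1`) with measurable slices, smooth on `(−∞,0) × ℝ³`, planar flux `≤ M'` on every plane
and slice, and a point of NON-ZERO curl on a slice `t < 0` (near-records `w_n = |ω(t_n,x_n)| → ∞`, `|ω| ≤ 2w_n`
on `(0,t_n]` — pattern `exists_near_max`; `v_n = c_n • stPull (c_n²) c_n t_n x_n u`, `c_n² = 1/w_n`:
`|curl v_n| ≤ 2` on `(A_n,0]`, `|curl v_n(0,0)| = 1`, `|v_n|² ≤ 24M/π` by `stub_fluxVelocity`, flux `≤ M`;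
Oseen-mildness `mild_of_bounded_of_eLpNorm_two_le_of_lt`; compactness `KNSS2009_lemma61_oseenMild`; smoothness and
uniform `C²`/time-Lipschitz bounds by the window regularity; `∇v_{φj}(t) → ∇v(t)` pointwise by `stub_fderivLimit`;
Fatou on planes; `|curl v(s*,0)| ≥ 3/4` at a fixed `s* < 0` by the uniform time-Lipschitz bound of `∇v_n` on
`(−1/2,0)` and continuity of `∇v_n(·)(0)` at `0`). -/
theorem stub_zoomCoreUnit :
    (∀ (v : EuclideanSpace ℝ (Fin 3) → EuclideanSpace ℝ (Fin 3)), ContDiff ℝ 2 v →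
      Literature.Analysis.FluidPDE.VectorCalculus.IsDivFree v →
      (∫⁻ y, ‖v y‖ₑ ^ 2 < ⊤) →
      ∀ (W Φ : ℝ), 0 ≤ W → 0 ≤ Φ →
        (∀ x, ‖Literature.Analysis.FluidPDE.curl v x‖ ≤ W) →
        (∀ (R : EuclideanSpace ℝ (Fin 3) ≃ₗᵢ[ℝ] EuclideanSpace ℝ (Fin 3)) (c : ℝ),
          ∫⁻ y : EuclideanSpace ℝ (Fin 2),
            ‖inner ℝ (Literature.Analysis.FluidPDE.curl v (R (WithLp.toLp 2 ![y 0, y 1, c])))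
              (R (EuclideanSpace.single 2 1))‖ₑ ≤ ENNReal.ofReal Φ) →
        ∀ x, ‖v x‖ ^ 2 ≤ 12 / Real.pi * W * Φ) →
    (∀ (N a b : ℝ), a < b → ∃ (C L : ℕ → ℝ → ℝ),
      ∀ (V : ℝ → EuclideanSpace ℝ (Fin 3) → EuclideanSpace ℝ (Fin 3)),
        ContinuousOn (Function.uncurry V) (Set.Ioo a b ×ˢ Set.univ) →
        (∀ t ∈ Set.Ioo a b, Literature.Analysis.FluidPDE.IsWeaklyDivFree (V t)) →
        (∀ t ∈ Set.Ioo a b, ∀ x, ‖V t x‖ ≤ N) →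
        (∀ s t : ℝ, a < s → s < t → t < b → ∀ x,
          V t x = Literature.Analysis.UnboundedOperators.heatExtension (V s) (t - s) x -
            Literature.Analysis.FluidPDE.oseenDuhamel 1 s V V t x) →
        ContDiffOn ℝ (⊤ : ℕ∞) (Function.uncurry V) (Set.Ioo a b ×ˢ Set.univ) ∧
        (∀ t ∈ Set.Ioo a b, Literature.Analysis.FluidPDE.VectorCalculus.IsDivFree (V t)) ∧
        (∀ δ : ℝ, 0 < δ → ∀ k : ℕ, ∀ t ∈ Set.Ioo (a + δ) b, ∀ x,
          ‖iteratedFDeriv ℝ k (V t) x‖ ≤ C k δ) ∧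
        (∀ δ : ℝ, 0 < δ → ∀ k : ℕ, ∀ s ∈ Set.Ioo (a + δ) b, ∀ t ∈ Set.Ioo (a + δ) b, ∀ x,
          ‖iteratedFDeriv ℝ k (V t) x - iteratedFDeriv ℝ k (V s) x‖ ≤ L k δ * |t - s|)) →
    (∀ (V : ℝ → EuclideanSpace ℝ (Fin 3) → EuclideanSpace ℝ (Fin 3)) (N : ℝ),
      ContinuousOn (Function.uncurry V) (Set.Iio 0 ×ˢ Set.univ) →
      (∀ t < 0, Literature.Analysis.FluidPDE.IsWeaklyDivFree (V t)) →
      (∀ t < 0, ∀ x, ‖V t x‖ ≤ N) →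
      (∀ s t : ℝ, s < t → t < 0 → ∀ x,
        V t x = Literature.Analysis.UnboundedOperators.heatExtension (V s) (t - s) x -
          Literature.Analysis.FluidPDE.oseenDuhamel 1 s V V t x) →
      Literature.Analysis.FluidPDE.IsBoundedAncientMildSolution 1 V ∧
        ∀ t < 0, MeasureTheory.AEStronglyMeasurable (V t) MeasureTheory.volume) →
    (∀ (C : ℝ) (f : ℕ → EuclideanSpace ℝ (Fin 3) → EuclideanSpace ℝ (Fin 3))
      (g : EuclideanSpace ℝ (Fin 3) → EuclideanSpace ℝ (Fin 3)) (x : EuclideanSpace ℝ (Fin 3)),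
      (∀ᶠ j in Filter.atTop, ContDiff ℝ 2 (f j) ∧ ∀ y, ‖iteratedFDeriv ℝ 2 (f j) y‖ ≤ C) →
      ContDiff ℝ 2 g → (∀ y, ‖iteratedFDeriv ℝ 2 g y‖ ≤ C) →
      TendstoLocallyUniformly f g Filter.atTop →
      Filter.Tendsto (fun j => fderiv ℝ (f j) x) Filter.atTop (nhds (fderiv ℝ g x))) →
    (∀ (V : ℝ → EuclideanSpace ℝ (Fin 3) → EuclideanSpace ℝ (Fin 3)) (a b : ℝ),
      ContDiffOn ℝ (⊤ : ℕ∞) (Function.uncurry V) (Set.Ioo a b ×ˢ Set.univ) →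
      ∀ x, ContinuousOn (fun t => fderiv ℝ (V t) x) (Set.Ioo a b)) →
    (∀ (u : ℝ → EuclideanSpace ℝ (Fin 3) → EuclideanSpace ℝ (Fin 3)) (t₀ : ℝ)
      (x₀ : EuclideanSpace ℝ (Fin 3)) (c : ℝ), 0 < c → ∀ s : ℝ,
      (∫⁻ y, ‖(c • Literature.Analysis.FluidPDE.stPull (c ^ 2) c t₀ x₀ u) s y‖ₑ ^ 2 =
          ENNReal.ofReal c⁻¹ * ∫⁻ x, ‖u (t₀ + c ^ 2 * s) x‖ₑ ^ 2) ∧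
      (Differentiable ℝ (u (t₀ + c ^ 2 * s)) →
        (∀ y, Literature.Analysis.FluidPDE.curl ((c • Literature.Analysis.FluidPDE.stPull (c ^ 2) c t₀ x₀ u) s) y =
          c ^ 2 • Literature.Analysis.FluidPDE.curl (u (t₀ + c ^ 2 * s)) (x₀ + c • y)) ∧
        (∀ (R : EuclideanSpace ℝ (Fin 3) ≃ₗᵢ[ℝ] EuclideanSpace ℝ (Fin 3)) (c' : ℝ),
          ∫⁻ y : EuclideanSpace ℝ (Fin 2),
            ‖inner ℝ (Literature.Analysis.FluidPDE.curl
                ((c • Literature.Analysis.FluidPDE.stPull (c ^ 2) c t₀ x₀ u) s)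
                (R (WithLp.toLp 2 ![y 0, y 1, c']))) (R (EuclideanSpace.single 2 1))‖ₑ =
          ∫⁻ y : EuclideanSpace ℝ (Fin 2),
            ‖inner ℝ (Literature.Analysis.FluidPDE.curl (u (t₀ + c ^ 2 * s))
                (R (WithLp.toLp 2 ![y 0, y 1, (R.symm x₀) 2 + c * c']))) (R (EuclideanSpace.single 2 1))‖ₑ))) →
    ∀ (T : ℝ), 0 < T →
      ∀ (u : ℝ → EuclideanSpace ℝ (Fin 3) → EuclideanSpace ℝ (Fin 3))
        (p : ℝ → EuclideanSpace ℝ (Fin 3) → ℝ),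
        Literature.Analysis.FluidPDE.IsClassicalNSSolutionOn (Set.Ico 0 T) 1 0 u p →
        (∃ K : ENNReal, K < ⊤ ∧ ∀ t ∈ Set.Ico 0 T, ∫⁻ x, ‖u t x‖ₑ ^ 2 ≤ K) →
        (∃ M : ℝ, ∀ t ∈ Set.Ico 0 T,
          ∀ (R : EuclideanSpace ℝ (Fin 3) ≃ₗᵢ[ℝ] EuclideanSpace ℝ (Fin 3)) (c : ℝ),
            ∫⁻ y : EuclideanSpace ℝ (Fin 2),
              ‖inner ℝ (Literature.Analysis.FluidPDE.curl (u t) (R (WithLp.toLp 2 ![y 0, y 1, c])))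
                (R (EuclideanSpace.single 2 1))‖ₑ ≤ ENNReal.ofReal M) →
        (∀ T' ∈ Set.Ioo 0 T, ∃ B : ℝ, ∀ t ∈ Set.Icc 0 T', ∀ x,
          ‖u t x‖ ≤ B ∧ ‖Literature.Analysis.FluidPDE.curl (u t) x‖ ≤ B) →
        (¬ ∃ W : ℝ, ∀ t ∈ Set.Ico 0 T, ∀ x, ‖Literature.Analysis.FluidPDE.curl (u t) x‖ ≤ W) →
        ∃ (v : ℝ → EuclideanSpace ℝ (Fin 3) → EuclideanSpace ℝ (Fin 3)) (M' : ℝ),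
          Literature.Analysis.FluidPDE.IsBoundedAncientMildSolution 1 v ∧
          (∀ t < 0, MeasureTheory.AEStronglyMeasurable (v t) MeasureTheory.volume) ∧
          ContDiffOn ℝ (⊤ : ℕ∞) (Function.uncurry v) (Set.Iio 0 ×ˢ Set.univ) ∧
          (∀ t < 0, ∀ (R : EuclideanSpace ℝ (Fin 3) ≃ₗᵢ[ℝ] EuclideanSpace ℝ (Fin 3)) (c : ℝ),
            ∫⁻ y : EuclideanSpace ℝ (Fin 2),
              ‖inner ℝ (Literature.Analysis.FluidPDE.curl (v t) (R (WithLp.toLp 2 ![y 0, y 1, c])))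
                (R (EuclideanSpace.single 2 1))‖ₑ ≤ ENNReal.ofReal M') ∧
          ∃ t < 0, ∃ x, Literature.Analysis.FluidPDE.curl (v t) x ≠ 0 :=
  Theorems.FluxZoom.Registered.stub_zoomCoreUnit

/-- **stub 12 — `stub_viscosityNormalization` (S–M, bookkeeping).** The unit-viscosity zoom statement
(`stub_zoomCoreUnit`'s conclusion) implies the general one: for `ν > 0` pass to `ũ(s,x) = ν⁻¹u(s/ν,x)`,
`p̃ = ν⁻²p(s/ν,·)` on `[0,νT)` (`IsClassicalNSSolutionOn.viscosityRescale_set` with `Set.Ico`, `timeRescale`);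
the Leray–Hopf energy inequality gives the uniform `L²` bound (`IsLerayHopfOn.lintegral_enorm_sq_le`,
`lintegral_enorm_sq_const_smul`), `curl ũ(s) = ν⁻¹ curl u(s/ν)` (`curl_const_smul_eq`) transports the flux bound
(`M ↦ M/ν`), the sub-slab bounds (`B ↦ B/ν`) and the unboundedness; the conclusion does not mention `u`. -/
theorem stub_viscosityNormalization :
    (∀ (T : ℝ), 0 < T →
      ∀ (u : ℝ → EuclideanSpace ℝ (Fin 3) → EuclideanSpace ℝ (Fin 3))
        (p : ℝ → EuclideanSpace ℝ (Fin 3) → ℝ),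
        Literature.Analysis.FluidPDE.IsClassicalNSSolutionOn (Set.Ico 0 T) 1 0 u p →
        (∃ K : ENNReal, K < ⊤ ∧ ∀ t ∈ Set.Ico 0 T, ∫⁻ x, ‖u t x‖ₑ ^ 2 ≤ K) →
        (∃ M : ℝ, ∀ t ∈ Set.Ico 0 T,
          ∀ (R : EuclideanSpace ℝ (Fin 3) ≃ₗᵢ[ℝ] EuclideanSpace ℝ (Fin 3)) (c : ℝ),
            ∫⁻ y : EuclideanSpace ℝ (Fin 2),
              ‖inner ℝ (Literature.Analysis.FluidPDE.curl (u t) (R (WithLp.toLp 2 ![y 0, y 1, c])))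
                (R (EuclideanSpace.single 2 1))‖ₑ ≤ ENNReal.ofReal M) →
        (∀ T' ∈ Set.Ioo 0 T, ∃ B : ℝ, ∀ t ∈ Set.Icc 0 T', ∀ x,
          ‖u t x‖ ≤ B ∧ ‖Literature.Analysis.FluidPDE.curl (u t) x‖ ≤ B) →
        (¬ ∃ W : ℝ, ∀ t ∈ Set.Ico 0 T, ∀ x, ‖Literature.Analysis.FluidPDE.curl (u t) x‖ ≤ W) →
        ∃ (v : ℝ → EuclideanSpace ℝ (Fin 3) → EuclideanSpace ℝ (Fin 3)) (M' : ℝ),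
          Literature.Analysis.FluidPDE.IsBoundedAncientMildSolution 1 v ∧
          (∀ t < 0, MeasureTheory.AEStronglyMeasurable (v t) MeasureTheory.volume) ∧
          ContDiffOn ℝ (⊤ : ℕ∞) (Function.uncurry v) (Set.Iio 0 ×ˢ Set.univ) ∧
          (∀ t < 0, ∀ (R : EuclideanSpace ℝ (Fin 3) ≃ₗᵢ[ℝ] EuclideanSpace ℝ (Fin 3)) (c : ℝ),
            ∫⁻ y : EuclideanSpace ℝ (Fin 2),
              ‖inner ℝ (Literature.Analysis.FluidPDE.curl (v t) (R (WithLp.toLp 2 ![y 0, y 1, c])))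
                (R (EuclideanSpace.single 2 1))‖ₑ ≤ ENNReal.ofReal M') ∧
          ∃ t < 0, ∃ x, Literature.Analysis.FluidPDE.curl (v t) x ≠ 0) →
    ∀ (ν T : ℝ), 0 < ν → 0 < T →
      ∀ (u : ℝ → EuclideanSpace ℝ (Fin 3) → EuclideanSpace ℝ (Fin 3))
        (p : ℝ → EuclideanSpace ℝ (Fin 3) → ℝ),
        Literature.Analysis.FluidPDE.IsClassicalNSSolutionOn (Set.Ico 0 T) ν 0 u p →
        Literature.Analysis.FluidPDE.IsLerayHopfOn T ν 0 (u 0) u →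
        Literature.Analysis.FluidPDE.HasRapidSpatialDecay (u 0) →
        (∃ M : ℝ, ∀ t ∈ Set.Ico 0 T,
          ∀ (R : EuclideanSpace ℝ (Fin 3) ≃ₗᵢ[ℝ] EuclideanSpace ℝ (Fin 3)) (c : ℝ),
            ∫⁻ y : EuclideanSpace ℝ (Fin 2),
              ‖inner ℝ (Literature.Analysis.FluidPDE.curl (u t) (R (WithLp.toLp 2 ![y 0, y 1, c])))
                (R (EuclideanSpace.single 2 1))‖ₑ ≤ ENNReal.ofReal M) →
        (∀ T' ∈ Set.Ioo 0 T, ∃ B : ℝ, ∀ t ∈ Set.Icc 0 T', ∀ x,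
          ‖u t x‖ ≤ B ∧ ‖Literature.Analysis.FluidPDE.curl (u t) x‖ ≤ B) →
        (¬ ∃ W : ℝ, ∀ t ∈ Set.Ico 0 T, ∀ x, ‖Literature.Analysis.FluidPDE.curl (u t) x‖ ≤ W) →
        ∃ (v : ℝ → EuclideanSpace ℝ (Fin 3) → EuclideanSpace ℝ (Fin 3)) (M' : ℝ),
          Literature.Analysis.FluidPDE.IsBoundedAncientMildSolution 1 v ∧
          (∀ t < 0, MeasureTheory.AEStronglyMeasurable (v t) MeasureTheory.volume) ∧
          ContDiffOn ℝ (⊤ : ℕ∞) (Function.uncurry v) (Set.Iio 0 ×ˢ Set.univ) ∧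
          (∀ t < 0, ∀ (R : EuclideanSpace ℝ (Fin 3) ≃ₗᵢ[ℝ] EuclideanSpace ℝ (Fin 3)) (c : ℝ),
            ∫⁻ y : EuclideanSpace ℝ (Fin 2),
              ‖inner ℝ (Literature.Analysis.FluidPDE.curl (v t) (R (WithLp.toLp 2 ![y 0, y 1, c])))
                (R (EuclideanSpace.single 2 1))‖ₑ ≤ ENNReal.ofReal M') ∧
          ∃ t < 0, ∃ x, Literature.Analysis.FluidPDE.curl (v t) x ≠ 0 :=
  Theorems.FluxZoom.Registered.stub_viscosityNormalization

/-- **The zoom core (no longer a stub: composed).** `stub_zoomCore` of the previous registration, now the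
composition `stub_viscosityNormalization ∘ stub_zoomCoreUnit` (renamed `zoomCore_of_stubs`) fed with `stub_oseenWindowShift hreg`,
`stub_fderivLimit`, `stub_sliceFDerivContinuous`, `stub_zoomBookkeeping`. -/
theorem zoomCore_of_stubs :
    (∀ (v : EuclideanSpace ℝ (Fin 3) → EuclideanSpace ℝ (Fin 3)), ContDiff ℝ 2 v →
      Literature.Analysis.FluidPDE.VectorCalculus.IsDivFree v →
      (∫⁻ y, ‖v y‖ₑ ^ 2 < ⊤) →
      ∀ (W Φ : ℝ), 0 ≤ W → 0 ≤ Φ →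
        (∀ x, ‖Literature.Analysis.FluidPDE.curl v x‖ ≤ W) →
        (∀ (R : EuclideanSpace ℝ (Fin 3) ≃ₗᵢ[ℝ] EuclideanSpace ℝ (Fin 3)) (c : ℝ),
          ∫⁻ y : EuclideanSpace ℝ (Fin 2),
            ‖inner ℝ (Literature.Analysis.FluidPDE.curl v (R (WithLp.toLp 2 ![y 0, y 1, c])))
              (R (EuclideanSpace.single 2 1))‖ₑ ≤ ENNReal.ofReal Φ) →
        ∀ x, ‖v x‖ ^ 2 ≤ 12 / Real.pi * W * Φ) →
    (∀ (N T : ℝ), 0 < T → ∃ (C L : ℕ → ℝ → ℝ),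
      ∀ (V : ℝ → EuclideanSpace ℝ (Fin 3) → EuclideanSpace ℝ (Fin 3)),
        ContinuousOn (Function.uncurry V) (Set.Ioo 0 T ×ˢ Set.univ) →
        (∀ t ∈ Set.Ioo 0 T, Literature.Analysis.FluidPDE.IsWeaklyDivFree (V t)) →
        (∀ t ∈ Set.Ioo 0 T, ∀ x, ‖V t x‖ ≤ N) →
        (∀ s t : ℝ, 0 < s → s < t → t < T → ∀ x,
          V t x = Literature.Analysis.UnboundedOperators.heatExtension (V s) (t - s) x -
            Literature.Analysis.FluidPDE.oseenDuhamel 1 s V V t x) →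
        ContDiffOn ℝ (⊤ : ℕ∞) (Function.uncurry V) (Set.Ioo 0 T ×ˢ Set.univ) ∧
        (∀ t ∈ Set.Ioo 0 T, Literature.Analysis.FluidPDE.VectorCalculus.IsDivFree (V t)) ∧
        (∀ δ : ℝ, 0 < δ → ∀ k : ℕ, ∀ t ∈ Set.Ioo δ T, ∀ x,
          ‖iteratedFDeriv ℝ k (V t) x‖ ≤ C k δ) ∧
        (∀ δ : ℝ, 0 < δ → ∀ k : ℕ, ∀ s ∈ Set.Ioo δ T, ∀ t ∈ Set.Ioo δ T, ∀ x,
          ‖iteratedFDeriv ℝ k (V t) x - iteratedFDeriv ℝ k (V s) x‖ ≤ L k δ * |t - s|)) →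
    (∀ (V : ℝ → EuclideanSpace ℝ (Fin 3) → EuclideanSpace ℝ (Fin 3)) (N : ℝ),
      ContinuousOn (Function.uncurry V) (Set.Iio 0 ×ˢ Set.univ) →
      (∀ t < 0, Literature.Analysis.FluidPDE.IsWeaklyDivFree (V t)) →
      (∀ t < 0, ∀ x, ‖V t x‖ ≤ N) →
      (∀ s t : ℝ, s < t → t < 0 → ∀ x,
        V t x = Literature.Analysis.UnboundedOperators.heatExtension (V s) (t - s) x -
          Literature.Analysis.FluidPDE.oseenDuhamel 1 s V V t x) →
      Literature.Analysis.FluidPDE.IsBoundedAncientMildSolution 1 V ∧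
        ∀ t < 0, MeasureTheory.AEStronglyMeasurable (V t) MeasureTheory.volume) →
    ∀ (ν T : ℝ), 0 < ν → 0 < T →
      ∀ (u : ℝ → EuclideanSpace ℝ (Fin 3) → EuclideanSpace ℝ (Fin 3))
        (p : ℝ → EuclideanSpace ℝ (Fin 3) → ℝ),
        Literature.Analysis.FluidPDE.IsClassicalNSSolutionOn (Set.Ico 0 T) ν 0 u p →
        Literature.Analysis.FluidPDE.IsLerayHopfOn T ν 0 (u 0) u →
        Literature.Analysis.FluidPDE.HasRapidSpatialDecay (u 0) →
        (∃ M : ℝ, ∀ t ∈ Set.Ico 0 T,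
          ∀ (R : EuclideanSpace ℝ (Fin 3) ≃ₗᵢ[ℝ] EuclideanSpace ℝ (Fin 3)) (c : ℝ),
            ∫⁻ y : EuclideanSpace ℝ (Fin 2),
              ‖inner ℝ (Literature.Analysis.FluidPDE.curl (u t) (R (WithLp.toLp 2 ![y 0, y 1, c])))
                (R (EuclideanSpace.single 2 1))‖ₑ ≤ ENNReal.ofReal M) →
        (∀ T' ∈ Set.Ioo 0 T, ∃ B : ℝ, ∀ t ∈ Set.Icc 0 T', ∀ x,
          ‖u t x‖ ≤ B ∧ ‖Literature.Analysis.FluidPDE.curl (u t) x‖ ≤ B) →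
        (¬ ∃ W : ℝ, ∀ t ∈ Set.Ico 0 T, ∀ x, ‖Literature.Analysis.FluidPDE.curl (u t) x‖ ≤ W) →
        ∃ (v : ℝ → EuclideanSpace ℝ (Fin 3) → EuclideanSpace ℝ (Fin 3)) (M' : ℝ),
          Literature.Analysis.FluidPDE.IsBoundedAncientMildSolution 1 v ∧
          (∀ t < 0, MeasureTheory.AEStronglyMeasurable (v t) MeasureTheory.volume) ∧
          ContDiffOn ℝ (⊤ : ℕ∞) (Function.uncurry v) (Set.Iio 0 ×ˢ Set.univ) ∧
          (∀ t < 0, ∀ (R : EuclideanSpace ℝ (Fin 3) ≃ₗᵢ[ℝ] EuclideanSpace ℝ (Fin 3)) (c : ℝ),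
            ∫⁻ y : EuclideanSpace ℝ (Fin 2),
              ‖inner ℝ (Literature.Analysis.FluidPDE.curl (v t) (R (WithLp.toLp 2 ![y 0, y 1, c])))
                (R (EuclideanSpace.single 2 1))‖ₑ ≤ ENNReal.ofReal M') ∧
          ∃ t < 0, ∃ x, Literature.Analysis.FluidPDE.curl (v t) x ≠ 0 :=
  fun hvel hreg hmild =>
    stub_viscosityNormalization
      (stub_zoomCoreUnit hvel (stub_oseenWindowShift hreg) hmild stub_fderivLimit
        stub_sliceFDerivContinuous stub_zoomBookkeeping)

/-- The curl of a spatially constant field vanishes (every `fderiv` of a constant is `0`). -/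
theorem curl_const (b x : EuclideanSpace ℝ (Fin 3)) :
    Literature.Analysis.FluidPDE.curl (fun _ => b) x = 0 := by
  ext i
  fin_cases i <;> simp [Literature.Analysis.FluidPDE.curl]

/-- **Composition (the skeleton theorem).** The crux BY NAME from the seven registered stubs, used by
name: bounded vorticity on `[0,T)` would extend the solution (`stub_subslabBounds` (a)) against
`¬ HasSmoothExtensionPast`; so the vorticity is unbounded while velocity and vorticity are bounded on closed
sub-slabs (`stub_subslabBounds` (b)), and the vorticity-clock zoom `stub_zoomCore` — fed with the velocity
bound `stub_fluxVelocity (stub_unitScaleVelocity stub_nearFieldFlux)`, the window regularity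
`stub_oseenBoxRegularity` and the duality bridge `stub_oseenAncientMild` — yields the ancient solution with a
point of non-zero curl on a slice `t < 0`, which is therefore not spatially constant (`curl_const`). -/
theorem FluxZoom_of : Theses.SlicedKelvin.FluxZoom := by
  have h1 := stub_subslabBounds
  have hvel := stub_fluxVelocity (stub_unitScaleVelocity stub_nearFieldFlux)
  have hreg := stub_oseenBoxRegularity
  have hmild := stub_oseenAncientMild
  have hcore := zoomCore_of_stubs hvel hreg hmild
  intro ν T hν hT u p hcl hLH hdec hne hflux
  obtain ⟨hbkm, hsub⟩ := h1 ν T hν hT u p hcl hLH hdec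
  have hunb : ¬ ∃ W : ℝ, ∀ t ∈ Set.Ico 0 T, ∀ x, ‖Literature.Analysis.FluidPDE.curl (u t) x‖ ≤ W :=
    fun hW => hne (hbkm hW)
  obtain ⟨v, M', hv, hmeas, hsm, hfl, t, ht, x, hx⟩ :=
    hcore ν T hν hT u p hcl hLH hdec hflux hsub hunb
  refine ⟨v, M', hv, hmeas, hsm, hfl, t, ht, ?_⟩
  rintro ⟨b, hb⟩
  apply hx
  have hconst : v t = fun _ => b := funext hb
  rw [hconst]
  exact curl_const b x

end Summit.NavierStokesRegularity.NavierStokesRegularity.Cruxes.FluxZoom.Birth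

end
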